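import Summits.SmoothPoincare4.SmoothPoincare4.Theorems.SymplecticOrigamiGromovRecognitionRelEndWindLinAlg
import Literature.Geometry.Symplectic.AlmostComplexStructure
import Mathlib.Geometry.Manifold.ContMDiffMFDeriv
import Mathlib.Geometry.Manifold.VectorBundle.Hom
import Mathlib.Analysis.InnerProductSpace.PiL2

/-!
# Local constancy of the orientation sign of a leaf coordinate
(registered helper `helper_orientationSign_locallyConstant` of line `cross-cap-laurent`, crux
`GromovRecognitionRelEnd`, item stmt-SmoothPoincare4-11009)

For a smooth `π : X → ℂ` which is a submersion on the open set `N` of the almost complex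
`4`-manifold `(X, JX)` with `JX`-invariant kernels `ker dπ_y` (`y ∈ N`), the differential `dπ_y`
induces a complex structure `M_y` on `ℂ = ℝ²` (`dπ_y ∘ JX_y = M_y ∘ dπ_y`); its ORIENTATION SIGN is
the sign of `Im (M_y 1) = Im (dπ_y (JX_y ξ))` for any `ξ` with `dπ_y ξ = 1` (well defined and
non-zero by `helper_orientationSign_basic`).  `helper_orientationSign_locallyConstant`: this sign
is locally constant on `N`.

Proof.  Read both `y ↦ dπ_y` and `y ↦ JX_y` in the trivialisation of the tangent bundle at `y₀`
(Mathlib's `inTangentCoordinates` / `ContinuousLinearMap.inCoordinates`): the coordinate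
expressions `L y = dπ_y ∘ Ψ_y` and `Jt y = Φ_y ∘ JX_y ∘ Ψ_y` (`Φ_y`, `Ψ_y` the trivialisation maps,
mutually inverse over the chart domain of `y₀`) are continuous at `y₀` by `ContMDiffAt.mfderiv_const`
and by the smoothness of the section `JX` of the endomorphism bundle (`continuousAt_hom_bundle`),
and the orientation sign is invariant under this simultaneous conjugation.  The abstract core
`orSign_core` then runs the continuity argument: with `L y₀ ξ₁ = 1`, `L y₀ η₁ = I`, the vector
`w y := Im (L y η₁) • ξ₁ - Im (L y ξ₁) • η₁` depends continuously on `y`, `L y (w y) = d y` is REAL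
with `d y → 1`, so `(d y)⁻¹ • w y` is a preimage of `1` near `y₀` and the sign at `y` is the sign
of the continuous, non-vanishing `τ y := Im (L y (Jt y (w y)))`.
-/

noncomputable section

open scoped Manifold ContDiff Topology
open Set Function Filter Literature.Geometry.Symplectic

-- the prescribed namespace `Summit.<P>.<Sub>.…` duplicates `SmoothPoincare4` (P = Sub)
set_option linter.dupNamespace false

namespace Summit.SmoothPoincare4.SmoothPoincare4.Theorems.GromovRecognitionRelEnd.CrossCapLaurent

/-- Abstract core of `helper_orientationSign_locallyConstant`: if `L y : ℝ⁴ →L[ℝ] ℂ` and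
`J y : ℝ⁴ →L[ℝ] ℝ⁴` depend continuously on `y` at `y₀ ∈ S`, and on `S` each `J y` is a complex
structure, `L y` is onto and `ker (L y)` is `J y`-invariant, then the orientation sign
`sign (Im (L y (J y ξ)))` (`L y ξ = 1`) is constant on `O ∩ S` for some open `O ∋ y₀`. -/
theorem orSign_core {Y : Type*} [TopologicalSpace Y]
    (L : Y → (EuclideanSpace ℝ (Fin 4) →L[ℝ] ℂ))
    (J : Y → (EuclideanSpace ℝ (Fin 4) →L[ℝ] EuclideanSpace ℝ (Fin 4)))
    (S : Set Y) (y₀ : Y) (hy₀ : y₀ ∈ S)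
    (hL : ContinuousAt L y₀) (hJ : ContinuousAt J y₀)
    (hJJ : ∀ y ∈ S, ∀ v, J y (J y v) = -v)
    (hsurj : ∀ y ∈ S, Surjective (L y))
    (hker : ∀ y ∈ S, ∀ v, L y v = 0 → L y (J y v) = 0) :
    ∃ O : Set Y, IsOpen O ∧ y₀ ∈ O ∧ ∀ y ∈ O, y ∈ S →
      ∀ ξ₀ ξ, L y₀ ξ₀ = 1 → L y ξ = 1 →
        (0 < (L y₀ (J y₀ ξ₀)).im ↔ 0 < (L y (J y ξ)).im) := by
  obtain ⟨ξ₁, hξ₁⟩ := hsurj y₀ hy₀ 1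
  obtain ⟨η₁, hη₁⟩ := hsurj y₀ hy₀ Complex.I
  -- `c₁ y := L y ξ₁ → 1`, `c₂ y := L y η₁ → I`; `d y := det (c₁ y, c₂ y) → 1`;
  -- `w y := Im (c₂ y) • ξ₁ - Im (c₁ y) • η₁` has `L y (w y) = d y` (real), `w y₀ = ξ₁`
  set d : Y → ℝ := fun y => (L y ξ₁).re * (L y η₁).im - (L y η₁).re * (L y ξ₁).im with hd
  set w : Y → EuclideanSpace ℝ (Fin 4) := fun y => (L y η₁).im • ξ₁ - (L y ξ₁).im • η₁ with hw
  set τ : Y → ℝ := fun y => (L y (J y (w y))).im with hτ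
  have hc₁ : ContinuousAt (fun y => L y ξ₁) y₀ := hL.clm_apply continuousAt_const
  have hc₂ : ContinuousAt (fun y => L y η₁) y₀ := hL.clm_apply continuousAt_const
  have hre₁ : ContinuousAt (fun y => (L y ξ₁).re) y₀ := Complex.continuous_re.continuousAt.comp hc₁
  have him₁ : ContinuousAt (fun y => (L y ξ₁).im) y₀ := Complex.continuous_im.continuousAt.comp hc₁
  have hre₂ : ContinuousAt (fun y => (L y η₁).re) y₀ := Complex.continuous_re.continuousAt.comp hc₂
  have him₂ : ContinuousAt (fun y => (L y η₁).im) y₀ := Complex.continuous_im.continuousAt.comp hc₂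
  have hdc : ContinuousAt d y₀ := (hre₁.mul him₂).sub (hre₂.mul him₁)
  have hwc : ContinuousAt w y₀ := (him₂.smul continuousAt_const).sub (him₁.smul continuousAt_const)
  have hτc : ContinuousAt τ y₀ :=
    Complex.continuous_im.continuousAt.comp (hL.clm_apply (hJ.clm_apply hwc))
  have hd₀ : d y₀ = 1 := by simp [hd, hξ₁, hη₁]
  have hw₀ : w y₀ = ξ₁ := by simp [hw, hξ₁, hη₁]
  have hLw : ∀ y, L y (w y) = (d y : ℂ) := by
    intro y
    apply Complex.ext
    · simp [hw, hd]
      ring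
    · simp [hw, hd]
      ring
  have hτ₀ : τ y₀ ≠ 0 := by
    have h := (helper_orientationSign_basic (L y₀) (J y₀) ξ₁ ξ₁ (hJJ y₀ hy₀) (hsurj y₀ hy₀)
      (hker y₀ hy₀) hξ₁ hξ₁).2
    simpa [hτ, hw₀] using h
  have ev₁ : ∀ᶠ y in 𝓝 y₀, 0 < d y := by
    have h : Tendsto d (𝓝 y₀) (𝓝 1) := hd₀ ▸ hdc
    exact h.eventually_const_lt zero_lt_one
  have ev₂ : ∀ᶠ y in 𝓝 y₀, (0 < τ y₀ ↔ 0 < τ y) := by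
    rcases hτ₀.lt_or_gt with h | h
    · filter_upwards [hτc.eventually_lt_const h] with y hy
      exact ⟨fun h' => absurd h' (lt_asymm h), fun h' => absurd h' (lt_asymm hy)⟩
    · filter_upwards [hτc.eventually_const_lt h] with y hy
      exact ⟨fun _ => hy, fun _ => h⟩
  obtain ⟨O, hO, hOo, hy₀O⟩ := eventually_nhds_iff.mp (ev₁.and ev₂)
  refine ⟨O, hOo, hy₀O, fun y hyO hyS ξ₀ ξ hξ₀ hξ => ?_⟩
  obtain ⟨hdy, hiff⟩ := hO y hyO
  -- at `y`, `(d y)⁻¹ • w y` is a preimage of `1`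
  have h1 : L y ((d y)⁻¹ • w y) = 1 := by
    rw [map_smul, hLw, Complex.real_smul, ← Complex.ofReal_mul, inv_mul_cancel₀ hdy.ne',
      Complex.ofReal_one]
  have e1 := (helper_orientationSign_basic (L y) (J y) ξ _ (hJJ y hyS) (hsurj y hyS) (hker y hyS)
    hξ h1).1
  have e0 := (helper_orientationSign_basic (L y₀) (J y₀) ξ₀ ξ₁ (hJJ y₀ hy₀) (hsurj y₀ hy₀)
    (hker y₀ hy₀) hξ₀ hξ₁).1
  rw [e1, e0, map_smul, map_smul, Complex.smul_im, smul_eq_mul, mul_pos_iff_of_pos_left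
    (inv_pos.mpr hdy)]
  have h0 : (L y₀ (J y₀ ξ₁)).im = τ y₀ := by simp [hτ, hw₀]
  rw [h0]
  exact hiff

/-- J3: LOCAL CONSTANCY of the orientation sign of a leaf coordinate: for `π` a smooth submersion
on the open `N` whose kernels are `JX`-invariant, the sign of `Im (dπ_y (JX ξ))` (`dπ_y ξ = 1`) is
locally constant on `N`. -/
theorem helper_orientationSign_locallyConstant : ∀ (X : Type) [TopologicalSpace X] [T2Space X]
    [SecondCountableTopology X] [ChartedSpace (EuclideanSpace ℝ (Fin 4)) X] [IsManifold (𝓡 4) ∞ X]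
    (JX : AlmostComplexStructure (𝓡 4) ∞ X) (π : X → ℂ) (N : Set X),
    IsOpen N → ContMDiffOn (𝓡 4) 𝓘(ℝ, ℂ) ∞ π N →
    (∀ y ∈ N, Surjective (mfderiv (𝓡 4) 𝓘(ℝ, ℂ) π y)) →
    (∀ y ∈ N, ∀ ξ : TangentSpace (𝓡 4) y, mfderiv (𝓡 4) 𝓘(ℝ, ℂ) π y ξ = 0 →
      mfderiv (𝓡 4) 𝓘(ℝ, ℂ) π y (JX y ξ) = 0) →
    ∀ y₀ ∈ N, ∃ O : Set X, IsOpen O ∧ y₀ ∈ O ∧ ∀ y ∈ O ∩ N,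
      ∀ (ξ₀ : TangentSpace (𝓡 4) y₀) (ξ : TangentSpace (𝓡 4) y),
        (show ℂ from mfderiv (𝓡 4) 𝓘(ℝ, ℂ) π y₀ ξ₀) = 1 →
        (show ℂ from mfderiv (𝓡 4) 𝓘(ℝ, ℂ) π y ξ) = 1 →
        (0 < (show ℂ from mfderiv (𝓡 4) 𝓘(ℝ, ℂ) π y₀ (JX y₀ ξ₀)).im ↔
          0 < (show ℂ from mfderiv (𝓡 4) 𝓘(ℝ, ℂ) π y (JX y ξ)).im) := by
  intro X _ _ _ _ _ JX π N hN hπ hsurj hker y₀ hy₀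
  -- the tangent bundle trivialisation at `y₀` and the two families read in it
  set e := trivializationAt (EuclideanSpace ℝ (Fin 4)) (TangentSpace (𝓡 4)) y₀ with he
  set L : X → (EuclideanSpace ℝ (Fin 4) →L[ℝ] ℂ) :=
    inTangentCoordinates (𝓡 4) 𝓘(ℝ, ℂ) id π (fun y => mfderiv (𝓡 4) 𝓘(ℝ, ℂ) π y) y₀ with hL
  set Jt : X → (EuclideanSpace ℝ (Fin 4) →L[ℝ] EuclideanSpace ℝ (Fin 4)) := fun y =>
    ContinuousLinearMap.inCoordinates (EuclideanSpace ℝ (Fin 4)) (TangentSpace (𝓡 4))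
      (EuclideanSpace ℝ (Fin 4)) (TangentSpace (𝓡 4)) y₀ y y₀ y (JX y)
  have hLc : ContinuousAt L y₀ := by
    have hπy₀ : ContMDiffAt (𝓡 4) 𝓘(ℝ, ℂ) ∞ π y₀ := hπ.contMDiffAt (hN.mem_nhds hy₀)
    exact (hπy₀.mfderiv_const (m := 0) (by norm_num)).continuousAt
  have hJc : ContinuousAt Jt y₀ := by
    have h := JX.contMDiff.continuous.continuousAt (x := y₀)
    exact ((continuousAt_hom_bundle (RingHom.id ℝ) _).1 h).2
  have hL_apply : ∀ (y : X) (w : EuclideanSpace ℝ (Fin 4)),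
      L y w = mfderiv (𝓡 4) 𝓘(ℝ, ℂ) π y (e.symmL ℝ y w) := by
    intro y w
    simp only [hL, inTangentCoordinates, ContinuousLinearMap.inCoordinates,
      TangentBundle.continuousLinearMapAt_model_space, ContinuousLinearMap.comp_apply, he, id]
    rfl
  have hJ_apply : ∀ (y : X) (w : EuclideanSpace ℝ (Fin 4)),
      Jt y w = e.continuousLinearMapAt ℝ y (JX y (e.symmL ℝ y w)) := fun y w => rfl
  have hΦΨ : ∀ y ∈ (chartAt (EuclideanSpace ℝ (Fin 4)) y₀).source, ∀ w : EuclideanSpace ℝ (Fin 4),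
      e.continuousLinearMapAt ℝ y (e.symmL ℝ y w) = w := fun y hy w =>
    e.continuousLinearMapAt_symmL (by simpa [he] using hy) w
  have hΨΦ : ∀ y ∈ (chartAt (EuclideanSpace ℝ (Fin 4)) y₀).source, ∀ v : TangentSpace (𝓡 4) y,
      e.symmL ℝ y (e.continuousLinearMapAt ℝ y v) = v := fun y hy v =>
    e.symmL_continuousLinearMapAt (by simpa [he] using hy) v
  -- the conjugation identities on the chart domain of `y₀`
  have key : ∀ y ∈ (chartAt (EuclideanSpace ℝ (Fin 4)) y₀).source, ∀ ξ : TangentSpace (𝓡 4) y,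
      L y (e.continuousLinearMapAt ℝ y ξ) = mfderiv (𝓡 4) 𝓘(ℝ, ℂ) π y ξ ∧
        L y (Jt y (e.continuousLinearMapAt ℝ y ξ)) = mfderiv (𝓡 4) 𝓘(ℝ, ℂ) π y (JX y ξ) := by
    intro y hy ξ
    refine ⟨?_, ?_⟩
    · rw [hL_apply, hΨΦ y hy]
    · rw [hL_apply, hJ_apply, hΨΦ y hy, hΨΦ y hy]
  set S : Set X := {y | y ∈ (chartAt (EuclideanSpace ℝ (Fin 4)) y₀).source ∧ y ∈ N}
  have hy₀c : y₀ ∈ (chartAt (EuclideanSpace ℝ (Fin 4)) y₀).source := mem_chart_source _ y₀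
  -- `Jt y` squares to `-1` on `S`
  have hJJ : ∀ y ∈ S, ∀ v, Jt y (Jt y v) = -v := by
    rintro y ⟨hyc, -⟩ v
    rw [hJ_apply, hJ_apply, hΨΦ y hyc, JX.map_map, map_neg, hΦΨ y hyc]
  -- `L y` is onto on `S`
  have hLsurj : ∀ y ∈ S, Surjective (L y) := by
    rintro y ⟨hyc, hyN⟩ c
    obtain ⟨ξ, hξ⟩ := hsurj y hyN c
    exact ⟨e.continuousLinearMapAt ℝ y ξ, (key y hyc ξ).1.trans hξ⟩
  -- the kernel of `L y` is `Jt y`-invariant on `S`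
  have hLker : ∀ y ∈ S, ∀ v, L y v = 0 → L y (Jt y v) = 0 := by
    rintro y ⟨hyc, hyN⟩ v hv
    rw [hL_apply] at hv
    rw [hL_apply, hJ_apply, hΨΦ y hyc]
    exact hker y hyN _ hv
  obtain ⟨O, hOo, hy₀O, hO⟩ := orSign_core L Jt S y₀ ⟨hy₀c, hy₀⟩ hLc hJc hJJ hLsurj hLker
  refine ⟨O ∩ (chartAt (EuclideanSpace ℝ (Fin 4)) y₀).source,
    hOo.inter (chartAt (EuclideanSpace ℝ (Fin 4)) y₀).open_source, ⟨hy₀O, hy₀c⟩, ?_⟩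
  rintro y ⟨⟨hyO, hyc⟩, hyN⟩ ξ₀ ξ hξ₀ hξ
  obtain ⟨h0a, h0b⟩ := key y₀ hy₀c ξ₀
  obtain ⟨ha, hb⟩ := key y hyc ξ
  have h := hO y hyO ⟨hyc, hyN⟩ (e.continuousLinearMapAt ℝ y₀ ξ₀) (e.continuousLinearMapAt ℝ y ξ)
    (h0a.trans hξ₀) (ha.trans hξ)
  rw [h0b, hb] at h
  exact h

end Summit.SmoothPoincare4.SmoothPoincare4.Theorems.GromovRecognitionRelEnd.CrossCapLaurent

end
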